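import Literature.Probability.RandomPlanarGeometry.CurveSpace
import Literature.Probability.RandomPlanarGeometry.CurveMonotoneReparam
import HarnessLib

/-!
# Pasts compact — support file for `stub_pastsCompact`
(line `slit-continuous-restriction` of the crux `SAWLoopFugacityFlow.SimpleSubseqLimits`,
stmt-CriticalPhenomena-4982; registered skeleton
`Summits/CriticalPhenomena/SAWScalingLimit/Cruxes/SimpleSubseqLimits/Lines/slit_continuous_restriction.lean`)

Topology of the reparametrisation pseudo-metric on `Curve ℂ` (`Curve.lean`, `CurveSpace.lean`):
for a compact set `K` of curve classes, the set `pastSet K q b ρ ρ₀ η 0` of classes of truncations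
`γ|[0, w]` of representatives `γ` of members of `K`, cut at parameters `w` subject to three closed
constraints (tip `ρ`-close to `q`; stayed `ρ₀`-far from `q` and `η`-far from `b` on `[0, w]`), is
compact, and every open set containing it contains the `κ`-relaxed past set (`ρ + κ` in the tip
constraint) for some `κ > 0`.

Both follow from ONE extraction lemma (`exists_tendsto_subseq`), proved sequentially (`CurveClass ℂ`
is a metric space): from `mk γₙ ∈ K` pass to a subsequence with `mk γₙ → mk γ ∈ K`; choose
reparametrisations `φₙ` with `sup_u dist (γₙ u) (γ (φₙ u)) → 0` (`Curve.exists_dist_reparam_lt`);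
extract `φₙ wₙ → w` in the compact `[0, 1]`; the closed constraints pass to the limit
(`dist_apply_le_of_tendsto`, `le_dist_apply_of_tendsto`), and
`mk (truncate γₙ wₙ) → mk (truncate γ w)` (`tendsto_mk_truncate`) because truncation at a fixed
parameter is `1`-Lipschitz for the sup distance (`dist_truncate_le`), the truncation of `γ ∘ φ` at
`v` has the class of the truncation of `γ` at `φ v` (`mk_truncate_reparam`: two monotone traversals
of one arc, `Curve.reparamDist_eq_zero_of_monotone'`), and `w ↦ truncate γ w` is continuous
(`continuous_truncate`, uniform continuity of `γ` on `[0, 1]`).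

* `truncate`, `pastSet`, `PastsCompact` — verbatim from the line skeleton;
* `exists_tendsto_subseq` — the extraction lemma;
* `stub_pastsCompact : PastsCompact` — the registered stub.

No named facts. Sources: M. Aizenman, A. Burchard, Duke Math. J. 99 (1999), §2.1 (the space of
curves modulo reparametrisation) [AizenmanBurchard1999].
-/

noncomputable section

open Filter Topology Set Metric Function
open Literature.Probability.RandomPlanarGeometry
open scoped unitInterval

namespace Summit.CriticalPhenomena.SAWScalingLimit.Theorems.SimpleSubseqLimits.SlitRestriction.Pasts

/-! ## Vocabulary (verbatim from the line skeleton) -/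

/-- The **truncation** (past) of a curve at the parameter `w`, rescaled to `[0, 1]`: `s ↦ γ (w s)`.
[folklore] -/
def truncate (γ : Curve ℂ) (w : I) : Curve ℂ :=
  ⟨⟨fun s : I => γ ⟨(w : ℝ) * s, unitInterval.mul_mem w.2 s.2⟩,
    γ.continuous.comp ((continuous_const.mul continuous_subtype_val).subtype_mk _)⟩⟩

/-- The **constrained past set** of a set `K` of classes: classes of truncations `γ|[0, w]` of
representatives of members of `K`, cut at a parameter `w` where the curve is `(ρ + κ)`-close to `q`,
has stayed `ρ₀`-far from `q` and `η`-far from the point `b` on `[0, w]`. For `κ = 0` these are the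
candidate first-entrance pasts at the closed ball `B̄(q, ρ)`; `κ > 0` relaxes the tip constraint.
[folklore] -/
def pastSet (K : Set (CurveClass ℂ)) (q b : ℂ) (ρ ρ₀ η κ : ℝ) : Set (CurveClass ℂ) :=
  {p | ∃ (γ : Curve ℂ) (w : I), CurveClass.mk γ ∈ K ∧ dist (γ w) q ≤ ρ + κ ∧
      (∀ u : I, u ≤ w → ρ₀ ≤ dist (γ u) q) ∧ (∀ u : I, u ≤ w → η ≤ dist (γ u) b) ∧
      p = CurveClass.mk (truncate γ w)}

/-- **PASTS COMPACT** (helper statement of the transfer; topology of the reparametrisation pseudo-metric):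
for a compact set `K` of classes the constrained past set at `κ = 0` is compact, and every open set
containing it contains the `κ`-relaxed past set for some `κ > 0`. Both by one extraction lemma: from
`mk γₙ ∈ K`, `wₙ ∈ [0, 1]` extract `γ`, reparametrisations `φₙ` with `‖γₙ - γ ∘ φₙ‖ → 0` and
`φₙ wₙ → w`; closed constraints and truncations pass to the limit. Registered stub statement of crux
stmt-CriticalPhenomena-4982 (line slit-continuous-restriction), body verbatim from the line skeleton
`Cruxes/SimpleSubseqLimits/Lines/slit_continuous_restriction.lean`; a helper statement of this line,
not a literature fact, hence untagged and declared here; proved below (`stub_pastsCompact`). -/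
def PastsCompact : Prop :=
  ∀ (K : Set (CurveClass ℂ)), IsCompact K → ∀ (q b : ℂ) (ρ ρ₀ η : ℝ),
    IsCompact (pastSet K q b ρ ρ₀ η 0) ∧
    ∀ N : Set (CurveClass ℂ), IsOpen N → pastSet K q b ρ ρ₀ η 0 ⊆ N →
      ∃ κ : ℝ, 0 < κ ∧ pastSet K q b ρ ρ₀ η κ ⊆ N

/-! ## Truncation: sup bound, reparametrisation invariance of the class, continuity in the cut -/

/-- A uniform pointwise bound between the two rescaled parametrisations bounds the reparametrisation
distance of two truncations (the distance of curves is at most the sup distance,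
`Curve.dist_le_dist_toContinuousMap`). [folklore] -/
theorem dist_truncate_truncate_le {γ₁ γ₂ : Curve ℂ} {w₁ w₂ : I} {C : ℝ} (hC : 0 ≤ C)
    (h : ∀ s : I, dist (γ₁ ⟨(w₁ : ℝ) * s, unitInterval.mul_mem w₁.2 s.2⟩)
      (γ₂ ⟨(w₂ : ℝ) * s, unitInterval.mul_mem w₂.2 s.2⟩) ≤ C) :
    dist (truncate γ₁ w₁) (truncate γ₂ w₂) ≤ C :=
  (Curve.dist_le_dist_toContinuousMap _ _).trans ((ContinuousMap.dist_le hC).2 h)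

/-- Truncation at a fixed parameter is `1`-Lipschitz for the sup distance: a uniform pointwise bound
between two parametrisations bounds the distance of their truncations. [folklore] -/
theorem dist_truncate_le {γ₁ γ₂ : Curve ℂ} {d : ℝ} (h : ∀ u : I, dist (γ₁ u) (γ₂ u) ≤ d) (w : I) :
    dist (truncate γ₁ w) (truncate γ₂ w) ≤ d :=
  dist_truncate_truncate_le (dist_nonneg.trans (h 0)) fun _ => h _

/-- The truncation of a reparametrised curve `γ ∘ φ` at `v` and the truncation of `γ` at `φ v` are
two monotone continuous traversals (`x ↦ φ (v x)` and `x ↦ (φ v) x`) of the one arc `γ|[0, φ v]`,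
hence have the same class (`Curve.reparamDist_eq_zero_of_monotone'`). [folklore] -/
theorem mk_truncate_reparam (γ : Curve ℂ) (φ : I ≃o I) (v : I) :
    CurveClass.mk (truncate (γ.reparam φ) v) = CurveClass.mk (truncate γ (φ v)) := by
  rw [CurveClass.mk_eq_mk]
  have key : ∀ {s t : I}, (s : ℝ) = t → ((φ s : I) : ℝ) = φ t := fun h => by rw [Subtype.ext h]
  have hsc : Continuous fun x : ℝ => (⟨(v : ℝ) * projIcc 0 1 zero_le_one x,
      unitInterval.mul_mem v.2 (projIcc 0 1 zero_le_one x).2⟩ : I) :=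
    (continuous_const.mul (continuous_subtype_val.comp continuous_projIcc)).subtype_mk _
  refine Curve.reparamDist_eq_zero_of_monotone' (m := ((φ v : I) : ℝ)) (φ v).2.1
    (V := fun x => γ (projIcc 0 1 zero_le_one x))
    (h₁ := fun x => ((φ ⟨(v : ℝ) * projIcc 0 1 zero_le_one x,
      unitInterval.mul_mem v.2 (projIcc 0 1 zero_le_one x).2⟩ : I) : ℝ))
    (h₂ := fun x => ((φ v : I) : ℝ) * projIcc 0 1 zero_le_one x)
    (γ.continuous.comp continuous_projIcc).continuousOn
    (continuous_subtype_val.comp (φ.toHomeomorph.continuous.comp hsc))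
    (continuous_const.mul (continuous_subtype_val.comp continuous_projIcc))
    (fun x y hxy => Subtype.coe_le_coe.2 (φ.monotone (Subtype.mk_le_mk.2
      (mul_le_mul_of_nonneg_left (Subtype.coe_le_coe.2 (monotone_projIcc zero_le_one hxy))
        v.2.1))))
    (fun x y hxy => mul_le_mul_of_nonneg_left
      (Subtype.coe_le_coe.2 (monotone_projIcc zero_le_one hxy)) (φ v).2.1)
    ?_ (by simp) (key (by simp)) (by simp) (fun t => ?_) fun t => ?_
  · -- `h₁ 0 = 0`: `φ` fixes `0 = ⊥`
    have h0 : (⟨(v : ℝ) * projIcc (0 : ℝ) 1 zero_le_one 0,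
        unitInterval.mul_mem v.2 (projIcc (0 : ℝ) 1 zero_le_one 0).2⟩ : I) = ⊥ :=
      Subtype.ext (by simp only [projIcc_left, Subtype.coe_mk, mul_zero]; rfl)
    change ((φ _ : I) : ℝ) = 0
    rw [h0, φ.map_bot]
    rfl
  · -- the truncation of `γ ∘ φ` at `v`
    change γ (φ ⟨(v : ℝ) * t, _⟩) = γ (projIcc 0 1 zero_le_one ((φ _ : I) : ℝ))
    rw [projIcc_val]
    congr 2
    exact Subtype.ext (by simp [projIcc_val])
  · -- the truncation of `γ` at `φ v`
    change γ ⟨((φ v : I) : ℝ) * t, _⟩ =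
      γ (projIcc 0 1 zero_le_one (((φ v : I) : ℝ) * ((projIcc 0 1 zero_le_one (t : ℝ) : I) : ℝ)))
    rw [projIcc_val, projIcc_of_mem zero_le_one (unitInterval.mul_mem (φ v).2 t.2)]

/-- Truncations of a fixed curve depend continuously on the cut parameter, already for the sup
distance: `γ` is uniformly continuous on `[0, 1]` and `|w' s - w s| ≤ |w' - w|`. [folklore] -/
theorem continuous_truncate (γ : Curve ℂ) : Continuous fun w : I => truncate γ w := by
  rw [Metric.continuous_iff]
  intro w ε hε
  obtain ⟨δ, hδ, hU⟩ := Metric.uniformContinuous_iff.1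
    (CompactSpace.uniformContinuous_of_continuous γ.continuous) (ε / 2) (half_pos hε)
  refine ⟨δ, hδ, fun w' hw' => ?_⟩
  refine (dist_truncate_truncate_le (half_pos hε).le fun s => (hU ?_).le).trans_lt (half_lt_self hε)
  rw [Subtype.dist_eq, Real.dist_eq] at hw' ⊢
  change |(w' : ℝ) * s - (w : ℝ) * s| < δ
  rw [← sub_mul, abs_mul, abs_of_nonneg s.2.1]
  exact (mul_le_of_le_one_right (abs_nonneg _) s.2.2).trans_lt hw'

/-! ## Passing to the limit along reparametrisation-close sequences -/

section Limit

variable {γ : Curve ℂ} {γs : ℕ → Curve ℂ} {ws : ℕ → I} {φs : ℕ → I ≃o I} {ds : ℕ → ℝ} {w : I}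

/-- The tip constraint passes to the limit: `dist (γ (φₙ wₙ)) q ≤ dₙ + ρ + κₙ` and
`γ (φₙ wₙ) → γ w`. [folklore] -/
theorem dist_apply_le_of_tendsto (hd : Tendsto ds atTop (𝓝 0))
    (hclose : ∀ (n : ℕ) (u : I), dist (γs n u) (γ (φs n u)) ≤ ds n)
    (hw : Tendsto (fun n => φs n (ws n)) atTop (𝓝 w)) {q : ℂ} {ρ : ℝ} {κs : ℕ → ℝ}
    (hκ : Tendsto κs atTop (𝓝 0)) (htip : ∀ n, dist (γs n (ws n)) q ≤ ρ + κs n) :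
    dist (γ w) q ≤ ρ := by
  have h₁ : Tendsto (fun n => dist (γ (φs n (ws n))) q) atTop (𝓝 (dist (γ w) q)) :=
    ((γ.continuous.tendsto w).comp hw).dist tendsto_const_nhds
  have h₂ : Tendsto (fun n => ds n + (ρ + κs n)) atTop (𝓝 ρ) := by
    simpa using hd.add (tendsto_const_nhds.add hκ)
  refine le_of_tendsto_of_tendsto' h₁ h₂ fun n => ?_
  have := dist_triangle_left (γ (φs n (ws n))) q (γs n (ws n))
  linarith [hclose n (ws n), htip n]

/-- A "stayed `r`-far from `a` on `[0, wₙ]`" constraint passes to the limit: for `u ≤ w` the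
parameters `min u (φₙ wₙ) → u` pull back under `φₙ⁻¹` to parameters `≤ wₙ`. [folklore] -/
theorem le_dist_apply_of_tendsto (hd : Tendsto ds atTop (𝓝 0))
    (hclose : ∀ (n : ℕ) (u : I), dist (γs n u) (γ (φs n u)) ≤ ds n)
    (hw : Tendsto (fun n => φs n (ws n)) atTop (𝓝 w)) {a : ℂ} {r : ℝ}
    (hfar : ∀ (n : ℕ) (u : I), u ≤ ws n → r ≤ dist (γs n u) a) :
    ∀ u : I, u ≤ w → r ≤ dist (γ u) a := by
  intro u hu
  have hv : Tendsto (fun n => min u (φs n (ws n))) atTop (𝓝 u) := by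
    simpa [min_eq_left hu] using (tendsto_const_nhds (x := u)).min hw
  have hlim : Tendsto (fun n => ds n + dist (γ (min u (φs n (ws n)))) a) atTop
      (𝓝 (dist (γ u) a)) := by
    simpa using hd.add (((γ.continuous.tendsto u).comp hv).dist tendsto_const_nhds)
  refine ge_of_tendsto' hlim fun n => ?_
  have hle : (φs n).symm (min u (φs n (ws n))) ≤ ws n :=
    (φs n).symm_apply_le.2 (min_le_right _ _)
  have h₁ := hfar n _ hle
  have h₂ := hclose n ((φs n).symm (min u (φs n (ws n))))
  rw [OrderIso.apply_symm_apply] at h₂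
  have h₃ := dist_triangle (γs n ((φs n).symm (min u (φs n (ws n)))))
    (γ (min u (φs n (ws n)))) a
  linarith

/-- The truncation classes converge:
`dist (truncate γₙ wₙ) (truncate γ w) ≤ dₙ + dist (truncate γ (φₙ wₙ)) (truncate γ w) → 0` by
`dist_truncate_le`, `mk_truncate_reparam` and `continuous_truncate`. [folklore] -/
theorem tendsto_mk_truncate (hd : Tendsto ds atTop (𝓝 0))
    (hclose : ∀ (n : ℕ) (u : I), dist (γs n u) (γ (φs n u)) ≤ ds n)
    (hw : Tendsto (fun n => φs n (ws n)) atTop (𝓝 w)) :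
    Tendsto (fun n => CurveClass.mk (truncate (γs n) (ws n))) atTop
      (𝓝 (CurveClass.mk (truncate γ w))) := by
  rw [tendsto_iff_dist_tendsto_zero]
  have hA : Tendsto (fun n => dist (truncate γ (φs n (ws n))) (truncate γ w)) atTop (𝓝 0) := by
    have h := ((continuous_truncate γ).tendsto w).comp hw
    rw [tendsto_iff_dist_tendsto_zero] at h
    exact h
  refine squeeze_zero (fun n => dist_nonneg) (fun n => ?_) (by simpa using hd.add hA)
  rw [CurveClass.dist_mk_mk]
  have hc : ∀ u : I, dist (γs n u) (γ.reparam (φs n) u) ≤ ds n := hclose n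
  calc dist (truncate (γs n) (ws n)) (truncate γ w)
      ≤ dist (truncate (γs n) (ws n)) (truncate (γ.reparam (φs n)) (ws n)) +
          dist (truncate (γ.reparam (φs n)) (ws n)) (truncate γ w) := dist_triangle _ _ _
    _ ≤ ds n + dist (truncate γ (φs n (ws n))) (truncate γ w) := by
        refine add_le_add (dist_truncate_le hc _) (le_of_eq ?_)
        rw [← CurveClass.dist_mk_mk, mk_truncate_reparam, CurveClass.dist_mk_mk]

end Limit

/-! ## The extraction lemma -/

/-- **Extraction.** From truncations of representatives `γₙ` of members of a compact `K`, cut at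
`wₙ` under the three constraints with tip slack `κₙ → 0`, extract a subsequence whose classes
converge to a member of the unrelaxed past set `pastSet K q b ρ ρ₀ η 0`: a subsequence of `mk γₙ`
converges to some `mk γ ∈ K`; reparametrisations `φₙ` realise `sup_u dist (γₙ u) (γ (φₙ u)) → 0`
(`Curve.exists_dist_reparam_lt`); a further subsequence of `φₙ wₙ` converges in `[0, 1]`; then the
constraints and the truncation classes pass to the limit. [folklore] -/
theorem exists_tendsto_subseq {K : Set (CurveClass ℂ)} (hK : IsCompact K) {q b : ℂ} {ρ ρ₀ η : ℝ}
    (γs : ℕ → Curve ℂ) (ws : ℕ → I) {κs : ℕ → ℝ} (hκ : Tendsto κs atTop (𝓝 0))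
    (hmem : ∀ n, CurveClass.mk (γs n) ∈ K) (htip : ∀ n, dist (γs n (ws n)) q ≤ ρ + κs n)
    (hfar : ∀ (n : ℕ) (u : I), u ≤ ws n → ρ₀ ≤ dist (γs n u) q)
    (hb : ∀ (n : ℕ) (u : I), u ≤ ws n → η ≤ dist (γs n u) b) :
    ∃ p ∈ pastSet K q b ρ ρ₀ η 0, ∃ ψ : ℕ → ℕ, StrictMono ψ ∧
      Tendsto (fun n => CurveClass.mk (truncate (γs (ψ n)) (ws (ψ n)))) atTop (𝓝 p) := by
  -- (1) a subsequence of the classes converges in `K`; fix a representative `γ` of the limit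
  obtain ⟨c, hcK, ψ₁, hψ₁, hlim⟩ := hK.tendsto_subseq hmem
  obtain ⟨γ, rfl⟩ := CurveClass.surjective_mk c
  have hdist : Tendsto (fun n => dist (γs (ψ₁ n)) γ) atTop (𝓝 0) := by
    have h := tendsto_iff_dist_tendsto_zero.1 hlim
    simpa only [Function.comp, CurveClass.dist_mk_mk] using h
  -- (2) reparametrisations realising the distances up to `1 / (n + 1)`
  have hφ : ∀ n, ∃ φ : I ≃o I,
      dist (γs (ψ₁ n)).toContinuousMap (γ.reparam φ).toContinuousMap <
        dist (γs (ψ₁ n)) γ + 1 / ((n : ℝ) + 1) := fun n =>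
    Curve.exists_dist_reparam_lt (lt_add_of_pos_right _ Nat.one_div_pos_of_nat)
  choose φ hφ using hφ
  have hds : Tendsto (fun n => dist (γs (ψ₁ n)) γ + 1 / ((n : ℝ) + 1)) atTop (𝓝 0) := by
    simpa using hdist.add tendsto_one_div_add_atTop_nhds_zero_nat
  have hclose : ∀ (n : ℕ) (u : I),
      dist (γs (ψ₁ n) u) (γ (φ n u)) ≤ dist (γs (ψ₁ n)) γ + 1 / ((n : ℝ) + 1) := fun n u => by
    have h := ContinuousMap.dist_apply_le_dist (f := (γs (ψ₁ n)).toContinuousMap)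
      (g := (γ.reparam (φ n)).toContinuousMap) (x := u)
    simp only [Curve.coe_toContinuousMap, Curve.reparam_apply] at h
    exact h.trans (hφ n).le
  -- (3) the cut parameters `φₙ wₙ` have a convergent subsequence in the compact `[0, 1]`
  obtain ⟨w, ψ₂, hψ₂, hw⟩ := CompactSpace.tendsto_subseq fun n => φ n (ws (ψ₁ n))
  -- (4) pass to the limit along `ψ₁ ∘ ψ₂`
  have hds' : Tendsto (fun n => dist (γs (ψ₁ (ψ₂ n))) γ + 1 / ((ψ₂ n : ℝ) + 1)) atTop (𝓝 0) :=
    hds.comp hψ₂.tendsto_atTop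
  have hclose' : ∀ (n : ℕ) (u : I), dist (γs (ψ₁ (ψ₂ n)) u) (γ (φ (ψ₂ n) u)) ≤
      dist (γs (ψ₁ (ψ₂ n))) γ + 1 / ((ψ₂ n : ℝ) + 1) := fun n u => hclose (ψ₂ n) u
  have hw' : Tendsto (fun n => φ (ψ₂ n) (ws (ψ₁ (ψ₂ n)))) atTop (𝓝 w) := hw
  have hκ' : Tendsto (fun n => κs (ψ₁ (ψ₂ n))) atTop (𝓝 0) :=
    hκ.comp (hψ₁.comp hψ₂).tendsto_atTop
  refine ⟨CurveClass.mk (truncate γ w), ⟨γ, w, hcK, ?_, ?_, ?_, rfl⟩, ψ₁ ∘ ψ₂, hψ₁.comp hψ₂, ?_⟩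
  · rw [add_zero]
    exact dist_apply_le_of_tendsto (γs := fun n => γs (ψ₁ (ψ₂ n))) (ws := fun n => ws (ψ₁ (ψ₂ n)))
      (φs := fun n => φ (ψ₂ n)) hds' hclose' hw' hκ' fun n => htip _
  · exact le_dist_apply_of_tendsto (γs := fun n => γs (ψ₁ (ψ₂ n))) (ws := fun n => ws (ψ₁ (ψ₂ n)))
      (φs := fun n => φ (ψ₂ n)) hds' hclose' hw' fun n => hfar _
  · exact le_dist_apply_of_tendsto (γs := fun n => γs (ψ₁ (ψ₂ n))) (ws := fun n => ws (ψ₁ (ψ₂ n)))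
      (φs := fun n => φ (ψ₂ n)) hds' hclose' hw' fun n => hb _
  · exact tendsto_mk_truncate (γs := fun n => γs (ψ₁ (ψ₂ n))) (ws := fun n => ws (ψ₁ (ψ₂ n)))
      (φs := fun n => φ (ψ₂ n)) hds' hclose' hw'

/-! ## The registered stub -/

/-- **stub 2c — PASTS COMPACT**: for a compact set `K` of classes the constrained past set at
`κ = 0` is compact (sequentially compact in the metric space `CurveClass ℂ`, by
`exists_tendsto_subseq` with `κₙ = 0`), and every open `N` containing it contains some
`κ`-relaxation (else members of `pastSet … (1 / (n + 1))` outside `N` would have, by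
`exists_tendsto_subseq`, a subsequence converging to a member of `pastSet … 0 ⊆ N`, contradicting
openness). -/
theorem stub_pastsCompact : PastsCompact := by
  intro K hK q b ρ ρ₀ η
  refine ⟨?_, fun N hN hsub => ?_⟩
  · refine IsSeqCompact.isCompact fun ps hps => ?_
    simp only [pastSet, Set.mem_setOf_eq] at hps
    choose γs ws hmem htip hfar hb heq using hps
    obtain ⟨p, hp, ψ, hψ, hlim⟩ := exists_tendsto_subseq hK γs ws (κs := fun _ => 0)
      tendsto_const_nhds hmem htip hfar hb
    refine ⟨p, hp, ψ, hψ, ?_⟩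
    have hfun : ps ∘ ψ = fun n => CurveClass.mk (truncate (γs (ψ n)) (ws (ψ n))) :=
      funext fun n => heq (ψ n)
    rw [hfun]
    exact hlim
  · by_contra hcon
    have hex : ∀ n : ℕ, ∃ p ∈ pastSet K q b ρ ρ₀ η (1 / ((n : ℝ) + 1)), p ∉ N := fun n => by
      by_contra h
      exact hcon ⟨1 / ((n : ℝ) + 1), Nat.one_div_pos_of_nat, fun p hp =>
        Classical.byContradiction fun hpN => h ⟨p, hp, hpN⟩⟩
    choose ps hps hnot using hex
    simp only [pastSet, Set.mem_setOf_eq] at hps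
    choose γs ws hmem htip hfar hb heq using hps
    obtain ⟨p, hp, ψ, hψ, hlim⟩ := exists_tendsto_subseq hK γs ws
      (κs := fun n : ℕ => 1 / ((n : ℝ) + 1)) tendsto_one_div_add_atTop_nhds_zero_nat hmem htip
      hfar hb
    obtain ⟨n, hn⟩ := (hlim.eventually (hN.mem_nhds (hsub hp))).exists
    exact hnot (ψ n) ((heq (ψ n)).symm ▸ hn)

end Summit.CriticalPhenomena.SAWScalingLimit.Theorems.SimpleSubseqLimits.SlitRestriction.Pasts

end
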